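import Summits.ResolutionOfSingularities.ResolutionOfSingularities.Theorems.PurelyInseparableDim4JointWaitingRootHostData
import Summits.ResolutionOfSingularities.ResolutionOfSingularities.Theorems.PurelyInseparableDim4JointWaitingNodes
import Summits.ResolutionOfSingularities.ResolutionOfSingularities.Theorems.PurelyInseparableDim4JointForestRootNormalised
import HarnessLib

/-!
# Purely inseparable four-folds: the joint forest from the ROOT with SEVERAL HOSTS, each with WAITING MEMBERS, and isolated points —
# model terms (brick S3 (c) «joint point∘coordinate chains», part 55 = v3 threading, root theorem; cell `res-dim4-pi`)

[OURS · counted 0] (D-0157 DOOR 2; desk WORD #66 (4)(c), #74 (g), #99 (d); frame `PIDim4.TerminationImpliesOrderReduction`, S3 (c) v3;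
host item stmt-ResolutionOfSingularities-16155, helper). Nothing here proves resolution of singularities in dimension ≥ 4 / characteristic
`p` — NOT here, not anywhere in this programme.

The threading node theorem (part 54) started at the root `(𝔸⁵, (z^p + F)·𝒪, ∅)` in MODEL TERMS, superseding part 42b's single host:
finitely many translated coordinate HOSTS `(b, S) ∈ hosts` (state `(deletePthPowers (F(x + b)), 0, ∅)`), EACH with its waiting entries
`wtab (b, S)` in root form, own block (three-way cover), hereditary two-way block, `Acc` data and same-chart separations (part 55a turns
each into `MemberData`); hosts pairwise SEPARATED by a parameter (`∃ i ∈ S ∩ S′, b_i ≠ b′_i`), hosts separated from the other hosts'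
regions, regions of different hosts separated; finitely many further closed order-`p` points (roots `b′` of all low-order coefficients
off hosts and regions) with well-founded finitely branching point walks. CONCLUSION: a marked resolution of `((z^p + F)·𝒪, ∅, p)`.
The hosts may be blown up in any order by the node theorem; their waiting members become members when their host goes.

* **`exists_isMarkedResolution_joint_forest_root_waiting_hosts`**.

AI-produced formalisation, weaker than expert review. bears_on: LADDER-RESOLUTION:D157-DOOR2 (res-dim4-pi · S3 (c) joint v3 · threading).
-/

set_option linter.dupNamespace false -- D-0017: single-problem summit path `Summit.<S>.<S>.…` by design

noncomputable section

open MvPolynomial Finset CategoryTheory AlgebraicGeometry Opposite TopologicalSpace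
open AlgebraicGeometry.Scheme.IdealSheafData (ofIdealTop vanishingIdeal)

namespace Summit.ResolutionOfSingularities.ResolutionOfSingularities.Theorems.PIDim4

open Literature.AlgebraicGeometry.Resolution
open Literature.AlgebraicGeometry.Resolution.Hauser2010
open Literature.AlgebraicGeometry.Resolution.AffinePointBlowup (P A γ coord Wtop ξ)

namespace Equimultiple

section RootHosts

variable {K : Type} [Field K] {p : ℕ} [hp : Fact p.Prime] [CharP K p]

/-- **THE JOINT FOREST FROM THE ROOT WITH SEVERAL HOSTS, WAITING MEMBERS AND ISOLATED POINTS (model terms).** See the module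
docstring. [cite: BierstoneGrigorievMilmanWlodarczyk2011, Def. 3.1.3; §4 Step 2b] [cite: Hauser2010, §§F–G]
[cite: HauserPerlega2019PRIMS, §2 (permissible centres P = (z, x_i : i ∈ Γ))]
[cite: Hironaka1964, Main Theorem I (the characteristic-zero statement whose analogue is asked)] -/
theorem exists_isMarkedResolution_joint_forest_root_waiting_hosts [IsAlgClosed K] [DecidableEq K] (F : MvPolynomial (Fin 4) K)
    (hF : F ≠ 0) (hclean : Literature.Barriers.ResolutionOfSingularities.HauserPerlega.IsClean p F)
    (plan : State K → Finset (Fin 4) → Finset (Fin 4 × (Fin 4 → K) × Finset (Fin 4)))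
    (leaves : State K → Finset (Fin 4) → Finset (Fin 4 × (Fin 4 → K)))
    (hosts : Finset ((Fin 4 → K) × Finset (Fin 4))) (hst : (Fin 4 → K) × Finset (Fin 4) → State K)
    (hhst : ∀ bS ∈ hosts, hst bS = ⟨deletePthPowers p (PointBlowup.translate bS.1 F), 0, ∅⟩)
    (wtab : (Fin 4 → K) × Finset (Fin 4) → Finset (Fin 4 × (Fin 4 → K) × Finset (Fin 4)))
    (hhost : ∀ bS ∈ hosts, IsPermissibleCentre p bS.2 (hst bS).F ∧ OwnBlock p plan leaves (wtab bS) (hst bS, bS.2) ∧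
      (∀ q : State K × Finset (Fin 4),
        ((∃ e ∈ plan (hst bS) bS.2, Relation.ReflTransGen (fun q q' : State K × Finset (Fin 4) =>
            ∃ e ∈ plan q.1 q.2, q' = (CentreBlowup.step p q.2 e.1 e.2.1 q.1, e.2.2))
            (CentreBlowup.step p bS.2 e.1 e.2.1 (hst bS), e.2.2) q) ∨
          ∃ wt ∈ wtab bS, Relation.ReflTransGen (fun q q' : State K × Finset (Fin 4) =>
            ∃ e ∈ plan q.1 q.2, q' = (CentreBlowup.step p q.2 e.1 e.2.1 q.1, e.2.2))
            (CentreBlowup.step p bS.2 wt.1 wt.2.1 (hst bS), wt.2.2) q) →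
        V2Block p plan leaves q) ∧
      Acc (fun q' q : State K × Finset (Fin 4) => ∃ e ∈ plan q.1 q.2, q' = (CentreBlowup.step p q.2 e.1 e.2.1 q.1, e.2.2))
        (hst bS, bS.2) ∧
      (∀ wt ∈ wtab bS, wt.1 ∈ bS.2 ∧ (∀ i ∈ bS.2, wt.2.1 i = 0) ∧ bS.2.erase wt.1 ⊆ wt.2.2 ∧ wt.1 ∉ wt.2.2 ∧
        IsPermissibleCentre p wt.2.2 (PointBlowup.translate wt.2.1 (hst bS).F) ∧
        Acc (fun q' q : State K × Finset (Fin 4) => ∃ e ∈ plan q.1 q.2, q' = (CentreBlowup.step p q.2 e.1 e.2.1 q.1, e.2.2))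
          (CentreBlowup.step p bS.2 wt.1 wt.2.1 (hst bS), wt.2.2)) ∧
      (∀ wt ∈ wtab bS, ∀ wt' ∈ wtab bS, wt ≠ wt' → wt.1 = wt'.1 → ∃ i ∈ wt.2.2, i ∈ wt'.2.2 ∧ wt.2.1 i ≠ wt'.2.1 i) ∧
      (∀ e ∈ plan (hst bS) bS.2, ∀ wt ∈ wtab bS, e.1 = wt.1 → ∃ i ∈ e.2.2, i ∈ wt.2.2 ∧ e.2.1 i ≠ wt.2.1 i))
    (hsep : ∀ bS ∈ hosts, ∀ bS' ∈ hosts, bS ≠ bS' → ∃ i ∈ bS.2, i ∈ bS'.2 ∧ bS.1 i ≠ bS'.1 i)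
    (hWsep : ∀ bS ∈ hosts, ∀ bS' ∈ hosts, bS ≠ bS' → ∀ wt ∈ wtab bS',
      ∃ i ∈ bS.2, i ∈ wt.2.2 ∧ bS.1 i ≠ bS'.1 i + wt.2.1 i)
    (hWWsep : ∀ bS ∈ hosts, ∀ bS' ∈ hosts, bS ≠ bS' → ∀ wt ∈ wtab bS, ∀ wt' ∈ wtab bS',
      ∃ i ∈ wt.2.2, i ∈ wt'.2.2 ∧ bS.1 i + wt.2.1 i ≠ bS'.1 i + wt'.2.1 i)
    (hroots : {b' : Fin 4 → K | (∀ d : Fin 4 →₀ ℕ, d ≠ 0 → d.degree < p →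
        coeff d (PointBlowup.translate b' F) = 0) ∧ (∀ bS ∈ hosts, ¬ ∀ i ∈ bS.2, b' i = bS.1 i) ∧
        ∀ bS ∈ hosts, ∀ wt ∈ wtab bS, ¬ ∀ i ∈ wt.2.2, b' i = bS.1 i + wt.2.1 i}.Finite)
    (hwalk₀ : ∀ b' : Fin 4 → K, (∀ d : Fin 4 →₀ ℕ, d ≠ 0 → d.degree < p → coeff d (PointBlowup.translate b' F) = 0) →
      (∀ bS ∈ hosts, ¬ ∀ i ∈ bS.2, b' i = bS.1 i) → (∀ bS ∈ hosts, ∀ wt ∈ wtab bS, ¬ ∀ i ∈ wt.2.2, b' i = bS.1 i + wt.2.1 i) →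
      Acc (fun s' s : State K => Edge p Finset.univ s s')
          (⟨deletePthPowers p (PointBlowup.translate b' F), 0, ∅⟩ : State K) ∧
        ∀ s' : State K, Relation.ReflTransGen (fun a e : State K => Edge p Finset.univ a e)
            (⟨deletePthPowers p (PointBlowup.translate b' F), 0, ∅⟩ : State K) s' →
          {jb : Fin 4 × (Fin 4 → K) | jb.2 jb.1 = 0 ∧
            CentreBlowup.IsEquimultiplePoint p Finset.univ jb.1 jb.2 s'}.Finite) :
    ∃ (X' : Scheme.{0}) (ρ : X' ⟶ P 4 K) (M' : MarkedIdeal X'),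
      IsMarkedResolution (⟨hypSheaf p F, [], p⟩ : MarkedIdeal (P 4 K)) ρ M' := by
  classical
  haveI : PerfectRing K p := PerfectRing.ofSurjective K p fun x => IsAlgClosed.exists_pow_nat_eq x hp.out.pos
  set M₀ : MarkedIdeal (P 4 K) := ⟨hypSheaf p F, [], p⟩ with hM₀
  have hE₀ : HasSNC M₀.boundary :=
    hasSNC_nil_of_isRegular (Literature.AlgebraicGeometry.Hironaka2017.Lib.AffinePointBlowupLSB.isRegular_Z 4 K)
  -- the hosts as `MemberData` (part 55a)
  have hpk : ∀ bS (h : bS ∈ hosts), ∃ (c₀ : Closeds (P 4 K)) (wr : Fin 4 × (Fin 4 → K) × Finset (Fin 4) → Closeds (P 4 K)),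
      MemberData p plan leaves M₀ c₀ (hst bS) bS.2 (wtab bS) wr ∧
      (∀ z : P 4 K, z ∈ (c₀ : Set (P 4 K)) → ∀ i ∈ bS.2, (X i.succ - C (bS.1 i) : A 4 K) ∈ z.asIdeal) ∧
      (∀ z : P 4 K, IsClosed ({z} : Set (P 4 K)) → (1 : ℕ∞) ≤ idealOrder (hypSheaf p F) z →
        (∀ i ∈ bS.2, (X i.succ - C (bS.1 i) : A 4 K) ∈ z.asIdeal) → z ∈ (c₀ : Set (P 4 K))) ∧
      (∀ wt ∈ wtab bS, ∀ z : P 4 K, z ∈ (wr wt : Set (P 4 K)) ↔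
        ∀ i ∈ wt.2.2, (X i.succ - C (bS.1 i + wt.2.1 i) : A 4 K) ∈ z.asIdeal) := fun bS h => by
    obtain ⟨hS, hown, hbelow, hacc, hwait, hW2, hPW⟩ := hhost bS h
    exact root_host_memberData F hF hclean plan leaves bS.1 bS.2 (hst bS) (hhst bS h) hS (wtab bS) hown hbelow hacc hwait
      hW2 hPW
  let cof : (Fin 4 → K) × Finset (Fin 4) → Closeds (P 4 K) := fun bS => if h : bS ∈ hosts then (hpk bS h).choose else ⊥
  let wrf : (Fin 4 → K) × Finset (Fin 4) → Fin 4 × (Fin 4 → K) × Finset (Fin 4) → Closeds (P 4 K) := fun bS =>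
    if h : bS ∈ hosts then (hpk bS h).choose_spec.choose else fun _ => ⊥
  have hspec : ∀ bS (h : bS ∈ hosts), MemberData p plan leaves M₀ (cof bS) (hst bS) bS.2 (wtab bS) (wrf bS) ∧
      (∀ z : P 4 K, z ∈ (cof bS : Set (P 4 K)) → ∀ i ∈ bS.2, (X i.succ - C (bS.1 i) : A 4 K) ∈ z.asIdeal) ∧
      (∀ z : P 4 K, IsClosed ({z} : Set (P 4 K)) → (1 : ℕ∞) ≤ idealOrder (hypSheaf p F) z →
        (∀ i ∈ bS.2, (X i.succ - C (bS.1 i) : A 4 K) ∈ z.asIdeal) → z ∈ (cof bS : Set (P 4 K))) ∧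
      (∀ wt ∈ wtab bS, ∀ z : P 4 K, z ∈ (wrf bS wt : Set (P 4 K)) ↔
        ∀ i ∈ wt.2.2, (X i.succ - C (bS.1 i + wt.2.1 i) : A 4 K) ∈ z.asIdeal) := by
    intro bS h
    have h1 : cof bS = (hpk bS h).choose := dif_pos h
    have h2 : wrf bS = (hpk bS h).choose_spec.choose := dif_pos h
    rw [h1, h2]
    exact (hpk bS h).choose_spec.choose_spec
  -- two coordinate values at one point are equal
  have hunit : ∀ (z : P 4 K) (i : Fin 4) (u v : K), (X i.succ - C u : A 4 K) ∈ z.asIdeal →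
      (X i.succ - C v : A 4 K) ∈ z.asIdeal → u = v := by
    intro z i u v h1 h2
    by_contra huv
    have h3 : (C (v - u) : A 4 K) ∈ z.asIdeal := by
      have h := z.asIdeal.sub_mem h1 h2
      rwa [sub_sub_sub_cancel_left, ← map_sub] at h
    exact z.2.ne_top (z.asIdeal.eq_top_of_isUnit_mem h3
      ((isUnit_iff_ne_zero.mpr (sub_ne_zero.mpr (Ne.symm huv))).map C))
  -- the hosts are non-empty, so `cof` is injective on `hosts`
  have hne : ∀ bS (h : bS ∈ hosts), ((cof bS : Set (P 4 K))).Nonempty := by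
    intro bS h
    obtain ⟨⟨-, -, -, -, -, ⟨Y, φ, ψ, _, _, -, hZ, -, hsee, -, -⟩, -⟩, -⟩ := hspec bS h
    have hξ := AffineCoordBlowup.ξ_mem_CΛ 4 K (insert 0 (Fin.succ '' (bS.2 : Set (Fin 4))))
    obtain ⟨y, hy⟩ := hsee hξ
    exact ⟨φ y, (mem_member_iff_mem_CΛ φ ψ _ hZ y).mpr (by rw [hy]; exact hξ)⟩
  have hcof_inj : ∀ bS ∈ hosts, ∀ bS' ∈ hosts, cof bS = cof bS' → bS = bS' := by
    intro bS h bS' h' hcc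
    by_contra hbb
    obtain ⟨i, hi, hi', hb⟩ := hsep bS h bS' h' hbb
    obtain ⟨z, hz⟩ := hne bS h
    exact hb (hunit z i _ _ ((hspec bS h).2.1 z hz i hi) ((hspec bS' h').2.1 z (by rw [← hcc]; exact hz) i hi'))
  set cms : Finset (Closeds (P 4 K)) := hosts.image cof with hcms
  let rep : Closeds (P 4 K) → (Fin 4 → K) × Finset (Fin 4) := fun c =>
    if h : ∃ bS ∈ hosts, cof bS = c then h.choose else ((0 : Fin 4 → K), (∅ : Finset (Fin 4)))
  have hrep : ∀ c ∈ cms, rep c ∈ hosts ∧ cof (rep c) = c := by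
    intro c hc
    have h : ∃ bS ∈ hosts, cof bS = c := by simpa [hcms, Finset.mem_image] using hc
    have hr : rep c = h.choose := dif_pos h
    rw [hr]
    exact h.choose_spec
  have hrep' : ∀ bS ∈ hosts, rep (cof bS) = bS := fun bS h =>
    hcof_inj _ (hrep _ (Finset.mem_image_of_mem cof h)).1 _ h (hrep _ (Finset.mem_image_of_mem cof h)).2
  set cst : Closeds (P 4 K) → State K := fun c => hst (rep c) with hcst
  set ctr : Closeds (P 4 K) → Finset (Fin 4) := fun c => (rep c).2 with hctr
  set went : Closeds (P 4 K) → Finset (Fin 4 × (Fin 4 → K) × Finset (Fin 4)) := fun c => wtab (rep c) with hwent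
  set wreg : Closeds (P 4 K) → Fin 4 × (Fin 4 → K) × Finset (Fin 4) → Closeds (P 4 K) := fun c => wrf (rep c) with hwreg
  -- the point members: closed order-`p` points off every host and every region
  have hfin₀ : {z : P 4 K | IsClosed ({z} : Set (P 4 K)) ∧ (p : ℕ∞) ≤ idealOrder (hypSheaf p F) z ∧
      (∀ bS ∈ hosts, z ∉ (cof bS : Set (P 4 K))) ∧ ∀ bS ∈ hosts, ∀ wt ∈ wtab bS, z ∉ (wrf bS wt : Set (P 4 K))}.Finite := by
    let pt : (Fin (4 + 1) → K) → P 4 K := fun v => ⟨MvPolynomial.vanishingIdeal K {v}, inferInstance⟩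
    let g : (Fin 4 → K) → P 4 K := fun b => pt (Fin.cons ((frobeniusEquiv K p).symm (-MvPolynomial.eval b F)) b)
    refine (hroots.image g).subset fun z hz => ?_
    obtain ⟨hzc, hord, hzoff, hzoffW⟩ := hz
    obtain ⟨a', b', hzab⟩ := exists_eq_vanishingIdeal_cons_of_isClosed hzc
    have hord' := (natCast_le_idealOrder_hypSheaf_iff (p := p) F hzab p).mp hord
    rw [natCast_le_ordZero_translate_hyp_iff] at hord'
    obtain ⟨hab, H⟩ := hord'
    have ha : (frobeniusEquiv K p).symm (-MvPolynomial.eval b' F) = a' := by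
      apply (frobeniusEquiv K p).injective
      rw [RingEquiv.apply_symm_apply, frobeniusEquiv_def]
      exact (eq_neg_of_add_eq_zero_left hab).symm
    refine ⟨b', ⟨H, fun bS hbS hall => hzoff bS hbS ?_, fun bS hbS wt hwt hall => hzoffW bS hbS wt hwt ?_⟩, ?_⟩
    · exact (hspec bS hbS).2.2.1 z hzc (le_trans (by exact_mod_cast hp.out.one_lt.le) hord)
        fun i hi => (X_succ_sub_C_mem_asIdeal_iff i _ a' b' hzab).mpr (hall i hi)
    · exact ((hspec bS hbS).2.2.2 wt hwt z).mpr fun i hi => (X_succ_sub_C_mem_asIdeal_iff i _ a' b' hzab).mpr (hall i hi)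
    · apply PrimeSpectrum.ext
      change MvPolynomial.vanishingIdeal K {(Fin.cons ((frobeniusEquiv K p).symm (-MvPolynomial.eval b' F)) b' :
        Fin (4 + 1) → K)} = z.asIdeal
      rw [ha, hzab]
  set pts : Finset (P 4 K) := hfin₀.toFinset with hpts
  have hmem_pts : ∀ z : P 4 K, z ∈ pts ↔ IsClosed ({z} : Set (P 4 K)) ∧ (p : ℕ∞) ≤ idealOrder (hypSheaf p F) z ∧
      (∀ bS ∈ hosts, z ∉ (cof bS : Set (P 4 K))) ∧ ∀ bS ∈ hosts, ∀ wt ∈ wtab bS, z ∉ (wrf bS wt : Set (P 4 K)) := fun z => by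
    rw [hpts, Set.Finite.mem_toFinset, Set.mem_setOf_eq]
  set st : P 4 K → State K := fun z =>
    if hz : IsClosed ({z} : Set (P 4 K)) then
      ⟨deletePthPowers p (PointBlowup.translate (exists_eq_vanishingIdeal_cons_of_isClosed hz).choose_spec.choose F),
        0, ∅⟩
    else ⟨F, 0, ∅⟩ with hst'
  refine exists_isMarkedResolution_of_waiting_node M₀ hE₀ rfl plan leaves pts st (fun z hz => ((hmem_pts z).mp hz).1)
    (fun z hz => ?_) cms cst ctr went wreg (fun c hc => ?_) (fun c hc c' hc' hcc => ?_) (fun c hc c' hc' hcc wt hwt => ?_)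
    (fun c hc c' hc' hcc wt hwt wt' hwt' => ?_) (fun z hz c hc => ?_) (fun z hz c hc wt hwt => ?_) (fun z hz hzo => ?_)
  · -- data of the point members (typ-3 g2's root charts)
    obtain ⟨hzc, hord, hzoff, hzoffW⟩ := (hmem_pts z).mp hz
    set a := (exists_eq_vanishingIdeal_cons_of_isClosed hzc).choose with ha
    set b := (exists_eq_vanishingIdeal_cons_of_isClosed hzc).choose_spec.choose with hb
    have hzab : z.asIdeal = MvPolynomial.vanishingIdeal K {(Fin.cons a b : Fin (4 + 1) → K)} :=
      (exists_eq_vanishingIdeal_cons_of_isClosed hzc).choose_spec.choose_spec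
    have hstz : st z = ⟨deletePthPowers p (PointBlowup.translate b F), 0, ∅⟩ := by rw [hst']; exact dif_pos hzc
    have hord' := (natCast_le_idealOrder_hypSheaf_iff (p := p) F hzab p).mp hord
    rw [natCast_le_ordZero_translate_hyp_iff] at hord'
    obtain ⟨hab, H⟩ := hord'
    have hord1 : (1 : ℕ∞) ≤ idealOrder (hypSheaf p F) z := le_trans (by exact_mod_cast hp.out.one_lt.le) hord
    have hoff : ∀ bS ∈ hosts, ¬ ∀ i ∈ bS.2, b i = bS.1 i := fun bS hbS hall =>
      hzoff bS hbS ((hspec bS hbS).2.2.1 z hzc hord1 fun i hi => (X_succ_sub_C_mem_asIdeal_iff i _ a b hzab).mpr (hall i hi))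
    have hoffW : ∀ bS ∈ hosts, ∀ wt ∈ wtab bS, ¬ ∀ i ∈ wt.2.2, b i = bS.1 i + wt.2.1 i := fun bS hbS wt hwt hall =>
      hzoffW bS hbS wt hwt (((hspec bS hbS).2.2.2 wt hwt z).mpr
        fun i hi => (X_succ_sub_C_mem_asIdeal_iff i _ a b hzab).mpr (hall i hi))
    obtain ⟨φ, _, hφ, hMφ⟩ := exists_chart_recenter (p := p) F a b hab hzab
    obtain ⟨hacc, hloc⟩ := hwalk₀ b H hoff hoffW
    rw [hstz]
    refine ⟨deletePthPowers_translate_ne_zero hF hclean b, isClean_deletePthPowers _,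
      ordAlong_univ_deletePthPowers_translate F b H, hacc, fun s' hs' => ?_, P 4 K, φ, 𝟙 _, inferInstance,
      inferInstance, ξ 4 K, hφ, rfl, by rw [Scheme.IdealSheafData.comap_id]; exact hMφ⟩
    exact finite_closedOver_model_of_finite_pairs s'
      (ordAlong_univ_of_reflTransGen_edge (ordAlong_univ_deletePthPowers_translate F b H) hs') (hloc s' hs')
  · -- data of the coordinate members
    obtain ⟨hr, hcr⟩ := hrep c hc
    have h := (hspec (rep c) hr).1
    rw [hcr] at h
    exact h
  · -- the members are pairwise disjoint (separated parameters)
    obtain ⟨hr, hcr⟩ := hrep c hc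
    obtain ⟨hr', hcr'⟩ := hrep c' hc'
    have hne' : rep c ≠ rep c' := fun h => hcc (by rw [← hcr, ← hcr', h])
    obtain ⟨i, hi, hi', hb⟩ := hsep _ hr _ hr' hne'
    refine Set.disjoint_left.mpr fun z hz hz' => hb (hunit z i _ _ ?_ ?_)
    · exact (hspec (rep c) hr).2.1 z (by rw [hcr]; exact hz) i hi
    · exact (hspec (rep c') hr').2.1 z (by rw [hcr']; exact hz') i hi'
  · -- members miss the other members' regions
    obtain ⟨hr, hcr⟩ := hrep c hc
    obtain ⟨hr', hcr'⟩ := hrep c' hc'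
    have hne' : rep c ≠ rep c' := fun h => hcc (by rw [← hcr, ← hcr', h])
    obtain ⟨i, hi, hi', hb⟩ := hWsep _ hr _ hr' hne' wt hwt
    refine Set.disjoint_left.mpr fun z hz hz' => hb (hunit z i _ _ ?_ ?_)
    · exact (hspec (rep c) hr).2.1 z (by rw [hcr]; exact hz) i hi
    · exact ((hspec (rep c') hr').2.2.2 wt hwt z).mp hz' i hi'
  · -- regions of different members are disjoint
    obtain ⟨hr, hcr⟩ := hrep c hc
    obtain ⟨hr', hcr'⟩ := hrep c' hc'
    have hne' : rep c ≠ rep c' := fun h => hcc (by rw [← hcr, ← hcr', h])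
    obtain ⟨i, hi, hi', hb⟩ := hWWsep _ hr _ hr' hne' wt hwt wt' hwt'
    refine Set.disjoint_left.mpr fun z hz hz' => hb (hunit z i _ _ ?_ ?_)
    · exact ((hspec (rep c) hr).2.2.2 wt hwt z).mp hz i hi
    · exact ((hspec (rep c') hr').2.2.2 wt' hwt' z).mp hz' i hi'
  · -- isolated points avoid the members
    obtain ⟨hr, hcr⟩ := hrep c hc
    rw [← hcr]
    exact ((hmem_pts z).mp hz).2.2.1 _ hr
  · -- isolated points avoid the regions
    exact ((hmem_pts z).mp hz).2.2.2 _ (hrep c hc).1 wt hwt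
  · -- every closed order-`p` point is an isolated point, on a host, or in a region
    by_cases h1 : ∃ bS ∈ hosts, z ∈ (cof bS : Set (P 4 K))
    · obtain ⟨bS, hbS, hzb⟩ := h1
      exact Or.inr (Or.inl ⟨cof bS, Finset.mem_image_of_mem cof hbS, hzb⟩)
    by_cases h2 : ∃ bS ∈ hosts, ∃ wt ∈ wtab bS, z ∈ (wrf bS wt : Set (P 4 K))
    · obtain ⟨bS, hbS, wt, hwt, hzb⟩ := h2
      refine Or.inr (Or.inr ⟨cof bS, Finset.mem_image_of_mem cof hbS, wt, ?_, ?_⟩)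
      · show wt ∈ wtab (rep (cof bS))
        rw [hrep' bS hbS]; exact hwt
      · show z ∈ (wrf (rep (cof bS)) wt : Set (P 4 K))
        rw [hrep' bS hbS]; exact hzb
    push Not at h1 h2
    exact Or.inl ((hmem_pts z).mpr ⟨hz, hzo, h1, fun bS hbS wt hwt => h2 bS hbS wt hwt⟩)

end RootHosts

end Equimultiple

end Summit.ResolutionOfSingularities.ResolutionOfSingularities.Theorems.PIDim4

end
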